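import Summits.BirchSwinnertonDyer.BirchSwinnertonDyer.Theorems.KolyvaginRankRigidityAtTwoStartFrameNearCoreHolds
import Summits.BirchSwinnertonDyer.BirchSwinnertonDyer.Theorems.KolyvaginRankRigidityAtTwoRegularCoreSupplyAtTwoRegularConductors
import HarnessLib

/-!
# Crux U1 `KolyvaginBoundedDefectAtTwo` (stmt-BirchSwinnertonDyer-28083), LINE 17 `regular_core_rigidity`:
# stub S1 `RegularCoreSupplyAtTwo` (v2) UNCONDITIONALLY, and the odd `2^∞`-Selmer corank over the Heegner field

Width seat `bsd-line-krr2-p2` g17 (ONE READER on S1); `--supports stmt-BirchSwinnertonDyer-28083` (helper).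
THEOREMS ONLY (no definition, no named-fact hypothesis, no `sorry`). TRANSPLANT label (critic #171):
MR04 Cor. 2.7.3 / Howard04 Selmer-rank lowering → `p = 2` via REGULAR Kolyvagin primes; the regular-prime supply
(`exists_regular_kolyvaginPrime_of_heegner`, `RegularCoreSupply.exists_regularKolyvaginConductor`) is imported, not re-proved.

STATE OF THE LINE. The named fact `Monsky1996_lemma14b_twoSelmerRank_parity` (`h14`) is a tree theorem (gk2-p5 g19,
`GenusKolyArch.Monsky1996_lemma14b_twoSelmerRank_parity_holds`), and gk2-p5's cross-line file `…StartFrameNearCoreHolds` feeds it to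
this lineage's g16 theorems: `RegularWalk.startFrameAtTwo_holds` (start frame) and `RegularWalk.nearCoreExistenceAtTwo_holds` = the body of
the registered v3 stub S1b `NearCoreExistenceAtTwo`, BYTE-FOR-BYTE, hypothesis-free. This file adds the two remaining unconditional exports:
* `RegularWalk.selmerCorank_two_odd` — on U1's habitat `corank_{ℤ₂} Sel_{2^∞}(E/K)` is ODD (g16's `selmerCorank_two_odd_of_twoSelmerParity`
  with `h14` discharged);
* **`RegularCoreSupply.regularCoreSupplyAtTwo`** — the body of LINE 17 v2's stub S1 `RegularCoreSupplyAtTwo` (the ONE READER's registered target,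
  director (280)(c)), BYTE-FOR-BYTE and hypothesis-free: S1 ⇐ S1b by g12's bookkeeping reduction `regularCoreSupply_of_nearCoreSupply` (p668568;
  Kolyvagin–Heegner datum from Gross §3 CM) applied to `nearCoreExistenceAtTwo_holds`.
Honest residual of LINE 17 after this: S0 (seed `KolyvaginNonvanishingAtTwoFrame`, the line's INPUT = Kolyvagin's conjecture at 2) and S2
(`CoreRigidityAtTwo`, core rigidity — THE crux, beyond print); the pen's print stub P17 (v3.2–v5.1) is a theorem, so v5.1's sorries reduce to {S0, S2}.
Nothing here proves S0, S2, U1, V1′∞, a rung or BSD. **BSD is NOT proved.**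
[cite: MazurRubin2004, Cor. 2.7.3, Def. 2.5.3] [cite: Howard2004, Thm. 1.6.1] [cite: GrossLMS1991, §3 (pp. 238–239), §4 (4.1)]
[cite: Monsky1996, Lemma 1.4(b)] [cite: Kramer1981, Thm. 1] [cite: Cassels1962ArithmeticIV, §1]
Design: no definitions; `K : Type`; axioms `propext`, `Classical.choice`, `Quot.sound`.
-/

set_option autoImplicit false
-- the Theorems namespace of this sub repeats the summit name by design (D-0017 nested layout)
set_option linter.dupNamespace false

noncomputable section

open scoped Classical
open Function NumberField IsDedekindDomain WeierstrassCurve Field Finset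
open Literature.NumberTheory.EllipticCurves Literature.NumberTheory.EllipticCurves.Jetchev2008
open Literature.NumberTheory.EllipticCurves.KolyvaginPairing
open Literature.NumberTheory.GaloisRepresentations Literature.NumberTheory.GaloisCohomology
open Literature.NumberTheory.GaloisRepresentations.DiscreteGaloisModule (transverseSubgroup SelmerStructure)
open Literature.NumberTheory.Automorphic Literature.NumberTheory
open Summit.BirchSwinnertonDyer.Rank1Residual
open Summit.BirchSwinnertonDyer.Rank1Residual.JET.SelmerVocabulary
open Summit.BirchSwinnertonDyer.BirchSwinnertonDyer.Theorems.GenusKolyArch (Monsky1996_lemma14b_twoSelmerRank_parity_holds)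

namespace Summit.BirchSwinnertonDyer.BirchSwinnertonDyer.Theorems.KolyvaginAtTwo.RegularWalk

/-- **`corank_{ℤ₂} Sel_{2^∞}(E/K)` is ODD** for an elliptic `W/ℚ` and an imaginary quadratic `K` in which `2` and every prime of
`N_W` split — UNCONDITIONALLY (g16's `selmerCorank_two_odd_of_twoSelmerParity` fed with the tree theorem
`Monsky1996_lemma14b_twoSelmerRank_parity_holds`). [cite: Monsky1996, Lemma 1.4(b)] [cite: Kramer1981, Thm. 1]
[cite: Cassels1962ArithmeticIV, §1] -/
theorem selmerCorank_two_odd (W : WeierstrassCurve ℚ) [W.IsElliptic] {K : Type} [Field K] [NumberField K]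
    (hK : IsImaginaryQuadratic K) (hH : SatisfiesHeegnerHypothesis (W.conductorNorm ℤ) K)
    (hH2 : SatisfiesHeegnerHypothesis 2 K) : (W.baseChange K).selmerCorank 2 % 2 = 1 :=
  selmerCorank_two_odd_of_twoSelmerParity Monsky1996_lemma14b_twoSelmerRank_parity_holds W hK hH hH2

end Summit.BirchSwinnertonDyer.BirchSwinnertonDyer.Theorems.KolyvaginAtTwo.RegularWalk

namespace Summit.BirchSwinnertonDyer.BirchSwinnertonDyer.Theorems.KolyvaginAtTwo.RegularCoreSupply

/-- **S1 `RegularCoreSupplyAtTwo` (LINE 17 v2 stub `stub_regularCoreSupplyAtTwo`, VERBATIM) — UNCONDITIONALLY** (director (280)(c) /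
critic #171: the ONE READER's target). On U1's habitat and frame there are a depth `r` and an error `κ` such that for every level
`M ≥ 1` and bound `b` some conductor `n` with exactly `r` prime factors, all regular Kolyvagin primes `> b` of Kolyvagin index `≥ M`,
carries a Kolyvagin–Heegner datum of the frame, is `KolSupp`, and is a sign-free near-core vertex of error `κ` at level `2^M`.
MR04 Cor. 2.7.3 ("core vertices `n` with `ω(n) = r` exist") TRANSPLANTED to `p = 2` with (H.2) := REGULARITY: S1b
(`RegularWalk.nearCoreExistenceAtTwo_holds`, hypothesis-free: g16 + gk2-p5) + g12's bookkeeping reduction `regularCoreSupply_of_nearCoreSupply`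
(Kolyvagin–Heegner datum from Gross §3 CM; p668568). [cite: MazurRubin2004, Cor. 2.7.3, Def. 2.5.3] [cite: Howard2004, Thm. 1.6.1]
[cite: GrossLMS1991, §3 (pp. 238–239), §4 (4.1)] -/
theorem regularCoreSupplyAtTwo :
    ∀ (W : WeierstrassCurve ℚ) [W.IsElliptic] [W.IsGloballyMinimal], ¬ W.HasCM → (Literature.NumberTheory.EllipticCurves.Rank1Residual.GoodOrd W 2 ∨ Literature.NumberTheory.EllipticCurves.Rank1Residual.Mult W 2) → (∀ m : ℕ, W.HasSurjectiveModNGaloisRep (2 ^ m : ℕ)) → ∀ (K : Type) [Field K] [NumberField K], Literature.NumberTheory.EllipticCurves.IsImaginaryQuadratic K → ∀ [NeZero (W.conductorNorm ℤ)], Literature.NumberTheory.EllipticCurves.SatisfiesHeegnerHypothesis (W.conductorNorm ℤ) K → Odd (NumberField.discr K) → NumberField.discr K ≠ -3 → AddSubgroup.torsionBy (W.baseChange K).toAffine.Point (2 : ℤ) = ⊥ → Literature.NumberTheory.EllipticCurves.SatisfiesHeegnerHypothesis 2 K → ∀ (Dt : Literature.NumberTheory.EllipticCurves.ModularForms.ModularParametrizationData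 W (W.conductorNorm ℤ)) (β : ℤ) (ι : K →+* ℂ) [∀ k : ℕ, NumberField (ringClassField K ι k)], (4 * (W.conductorNorm ℤ : ℤ)) ∣ β ^ 2 - NumberField.discr K →
    ∃ r κ : ℕ, ∀ (M b : ℕ), 1 ≤ M →
      ∃ n : ℕ, Nonempty (Literature.NumberTheory.EllipticCurves.KolyvaginHeegnerData Dt β ι n) ∧
        Literature.NumberTheory.EllipticCurves.KolyvaginDescent.KolSupp (Literature.NumberTheory.EllipticCurves.Zhang2014.IsKolyvaginPrime (W.conductorNorm ℤ) W K 2) n ∧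
        n.primeFactors.card = r ∧
        (∀ ℓ ∈ n.primeFactors, b < ℓ ∧ M ≤ Literature.NumberTheory.EllipticCurves.Zhang2014.kolyvaginIndex W 2 ℓ ∧ (∃ (v : HeightOneSpectrum (𝓞 ℚ)) (𝔓 : Ideal (absIntegers (𝓞 ℚ) ℚ)) (h : absoluteGaloisGroup ℚ), (ℓ : 𝓞 ℚ) ∈ v.asIdeal ∧ 𝔓 ∈ v.primesAbove ∧ IsArithFrobAt (𝓞 ℚ) h 𝔓 ∧ (∀ X : geomTorsion W ((2 ^ M : ℕ) : ℤ), h • h • X = X) ∧ ∃ P : geomTorsion W ((2 ^ M : ℕ) : ℤ), (2 : ℤ) ^ (M - 1) • (P + h • P) ≠ 0)) ∧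
        (∃ x ∈ Jetchev2008.modifiedSelmerGroup W K ι ((2 ^ M : ℕ) : ℤ) n, addOrderOf x = 2 ^ M ∧ ∀ y ∈ Jetchev2008.modifiedSelmerGroup W K ι ((2 ^ M : ℕ) : ℤ) n, ∃ t : ℤ, (2 ^ κ : ℤ) • y = t • x) := by
  intro W _ _ hCM hred hsurj K _ _ hK _ hH hodd hd3 htors hH2 Dt β ι _ hβ
  exact regularCoreSupply_of_nearCoreSupply hK hH Dt β ι hβ
    (RegularWalk.nearCoreExistenceAtTwo_holds W hCM hred hsurj K hK hH hodd hd3 htors hH2 Dt β ι hβ)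

end Summit.BirchSwinnertonDyer.BirchSwinnertonDyer.Theorems.KolyvaginAtTwo.RegularCoreSupply

end
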